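import Summits.HodgeConjecture.HodgeConjecture.Theorems.K2LiuInertFrameInputs
import Summits.HodgeConjecture.HodgeConjecture.Theorems.F0P2oDoubledSwapSiegel
import Literature.NumberTheory.GaloisRepresentations.HeckeLFunctionNonvanishingLineProofs
import Literature.NumberTheory.Automorphic.AdicCompletionResidueCard

/-!
# The Siegel scalars `e(p) = (chiDet χ⁻¹ p)⁻¹ · Π_{w'} √‖det_Δ p_{w'}‖` at an INERT place, the place data `√‖ϖ‖ = q⁻¹`, and the disjointness of the
# three pieces of the Hecke transversal (LOCAL SEAM of s23, inert package, organ (L24-b) (Σ-a))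

Track B ∕ K2-LIT, hLiu418 = stmt-HodgeConjecture-24832; LEAD F0P6-plan (g11) «M-155g» (ii) ∕ «M-155i» ((L24-b) by ROAD A′).  Helper (count-neutral, own head
per LEAD R3).  THEOREMS ONLY (no `def`, no instance, no notation, no named fact, no `sorry`).  The scalar bookkeeping of the final assembly (Σ):
* §1 PLACE DATA at an inert unramified `v` (`w` the place above, `ϖ` a uniformizer of `L_w`, `q = q_v`): `norm_eq_inv_sq` (`‖ϖ‖ = (q²)⁻¹`),
  `sqrt_norm_eq_inv` (`√‖ϖ‖ = q⁻¹`), `sqrt_norm_inv_eq` (`√‖ϖ⁻¹‖ = q`), `ne_one_of_valued`, `inv_ne_one_of_valued`, `ne_inv_of_valued`.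
* §2 THE SIEGEL SCALAR AT AN INERT PLACE (`S = L_w`, one place above `v`): if `det_Δ p_{w'} = α_{w'}` for all `w'` and `α_w = u ≠ 0`, then
  `(chiDet χ⁻¹ p)⁻¹ · Π √‖det_Δ p‖ = χ_w(u) · √‖u‖` (`siegelScalar_eq_of_detDelta_eq`); with `u = 1` it is `1`.
* §3 DISJOINTNESS of `X₊`, `X₀`, `{t₁⁻¹}` from the frame eigenvalues `α₊ ≠ 1`, `α₋ ≠ 1`, `α₊ ≠ α₋` on a vector `y` with a partner
  (`disjoint_of_mulVec_eq_smul`, `not_mem_of_mulVec_eq_smul`; ★ `F0P2oDoubledSwapSiegel.eq_zero_of_smul_eq_zero_of_partner`).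
[GelbartRogawski1991, §3.2 (3.2.2) p. 457]; [Kudla1994, §3 Thm. 3.1]; [HarrisKudlaSweet1996, §1 (1.15)–(1.16)]; [CasselsFrohlichANT1967, Ch. II §10].
HONEST LABEL: HC_CM is proved only modulo the printed citations (2 remaining named inputs: hLiu418 = stmt-HodgeConjecture-24832, h413 =
stmt-HodgeConjecture-24833) until rung 0 closes; this file is unconditional and moves no counter.
-/

set_option autoImplicit false

set_option linter.dupNamespace false

noncomputable section

open scoped Matrix Valued
open NumberField IsDedekindDomain Matrix MulAction
open Literature.NumberTheory.Automorphic Literature.NumberTheory.Automorphic.UnitaryGroup Literature.NumberTheory.Automorphic.CartanUnique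
open Literature.NumberTheory.GaloisRepresentations
open Literature.NumberTheory.GelbartRogawski1991 Literature.NumberTheory.GelbartRogawski1991.GRConstruction
open Literature.NumberTheory.GelbartRogawski1991.UnitaryDualPair Literature.NumberTheory.GelbartRogawski1991.UnitaryDualPair.LocalSplitting
open Summit.HodgeConjecture.HodgeConjecture.Cruxes.HLiu418.K2LiuInertHeckeRecursion
open Summit.HodgeConjecture.HodgeConjecture.Cruxes.H413.F0P2oDoubledSwapSiegel

namespace Summit.HodgeConjecture.HodgeConjecture.Cruxes.HLiu418.K2LiuInertSiegelScalars

variable (L : Type) [Field L] [NumberField L] [IsCMField L] (v : HeightOneSpectrum (𝓞 (Fp L)))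

/-! ## §1 Place data at an inert unramified place -/

section Place

variable (w : UnitaryGroup.PlacesOver L v) (hw : IsCMField.complexConj L • w.1 = w.1) (hv : Algebra.IsUnramifiedIn (𝓞 L) v.asIdeal)
  {ϖ : w.1.adicCompletion L} (hϖ : Valued.v ϖ = WithZero.exp (-1 : ℤ))

include hw hv hϖ in
/-- **`‖ϖ‖ = q_v⁻²`** at an inert unramified place (`N(w) = q_v²`, ★ `natCard_residueField_eq_sq_inert`). [cite: CasselsFrohlichANT1967, Ch. II §10] -/
theorem norm_eq_inv_sq : ‖ϖ‖ = (((v.residueCard ^ 2 : ℕ) : ℝ))⁻¹ := by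
  have hQ : w.1.residueCard = v.residueCard ^ 2 := by
    have h1 : Nat.card 𝓀[w.1.adicCompletion L] = w.1.residueCard := by
      rw [HeightOneSpectrum.residueCard_eq_card_quotient]
      exact IsDedekindDomain.HeightOneSpectrum.natCard_residueField_adicCompletion L w.1
    rw [← h1, natCard_residueField_eq_sq_inert L v w hw hv]
  have hnu : ‖(HeckeCharacter.uniformizer L w.1 : w.1.adicCompletion L)‖ = ((w.1.residueCard : ℝ))⁻¹ := HeckeCharacter.norm_uniformizer w.1
  rw [← hQ, ← hnu, NumberField.FinitePlace.norm_def, NumberField.FinitePlace.norm_def, hϖ, HeckeCharacter.valued_uniformizer (K := L) (v := w.1)]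

include hw hv hϖ in
/-- **`√‖ϖ‖ = q_v⁻¹`**. [cite: CasselsFrohlichANT1967, Ch. II §10] -/
theorem sqrt_norm_eq_inv : Real.sqrt ‖ϖ‖ = ((v.residueCard : ℝ))⁻¹ := by
  rw [norm_eq_inv_sq L v w hw hv hϖ, Nat.cast_pow, Real.sqrt_inv, Real.sqrt_sq (Nat.cast_nonneg _)]

include hw hv hϖ in
/-- **`√‖ϖ⁻¹‖ = q_v`**. [cite: CasselsFrohlichANT1967, Ch. II §10] -/
theorem sqrt_norm_inv_eq : Real.sqrt ‖ϖ⁻¹‖ = (v.residueCard : ℝ) := by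
  rw [norm_inv, norm_eq_inv_sq L v w hw hv hϖ, inv_inv, Nat.cast_pow, Real.sqrt_sq (Nat.cast_nonneg _)]

include hϖ in
omit [IsCMField L] in
/-- a uniformizer is not `1`. [folklore] -/
theorem ne_one_of_valued : ϖ ≠ 1 := by
  intro h
  rw [h, map_one, ← WithZero.exp_zero, WithZero.exp_inj] at hϖ
  omega

include hϖ in
omit [IsCMField L] in
/-- the inverse of a uniformizer is not `1`. [folklore] -/
theorem inv_ne_one_of_valued : ϖ⁻¹ ≠ 1 := fun h => ne_one_of_valued L v w hϖ (inv_eq_one.1 h)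

include hϖ in
omit [IsCMField L] in
/-- a uniformizer is not its own inverse (`v(ϖ²) ≠ 1`). [folklore] -/
theorem ne_inv_of_valued : ϖ ≠ ϖ⁻¹ := by
  intro h
  have hϖ0 : ϖ ≠ 0 := uniformizer_ne_zero hϖ
  have h2 : ϖ * ϖ = 1 := by
    nth_rewrite 1 [h]
    exact inv_mul_cancel₀ hϖ0
  have hval : Valued.v (ϖ * ϖ) = Valued.v (1 : w.1.adicCompletion L) := by rw [h2]
  rw [map_mul, map_one, hϖ, ← WithZero.exp_add, ← WithZero.exp_zero, WithZero.exp_inj] at hval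
  omega

end Place

/-! ## §2 The Siegel scalar at an inert place -/

section Scalar

variable (w : UnitaryGroup.PlacesOver L v) (hw : IsCMField.complexConj L • w.1 = w.1) (n : ℕ) {T₀ : Matrix (Fin n) (Fin n) (Fp L)}
  (χ : HeckeCharacter L)

include hw in
/-- **THE SIEGEL SCALAR AT AN INERT PLACE**: if `det_Δ p_{w'} = α_{w'}` at every `w' ∣ v` and `α_w = u ≠ 0`, then
`(chiDet χ⁻¹ p)⁻¹ · Π_{w'} √‖det_Δ p_{w'}‖ = χ_w(u) · √‖u‖` (one place above `v`). [cite: HarrisKudlaSweet1996, §1 (1.15)–(1.16)]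
[cite: Kudla1994, §3 Thm. 3.1] -/
theorem siegelScalar_eq_of_detDelta_eq
    (p : UnitaryGroup.localPi L (IsCMField.complexConj L) (n + n) ((gramD (Fp L) n T₀).map (algebraMap (Fp L) L)) v)
    (α : UnitaryGroup.LocalRing L v) (hdet : ∀ w' : UnitaryGroup.PlacesOver L v, detDelta (Fp L) L (IsCMField.complexConj L) v n w' p = α w')
    {u : w.1.adicCompletion L} (hu : α w = u) (hu0 : u ≠ 0) :
    (((LocalSplitting.chiDet (Fp L) L (IsCMField.complexConj L) v n (fun w' : UnitaryGroup.PlacesOver L v => (χ.localComponent w'.1)⁻¹) p)⁻¹ : ℂˣ) : ℂ) *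
        ((∏ w' : UnitaryGroup.PlacesOver L v, Real.sqrt ‖detDelta (Fp L) L (IsCMField.complexConj L) v n w' p‖ : ℝ) : ℂ) =
      ((χ.localComponent w.1 (Units.mk0 u hu0) : ℂˣ) : ℂ) * ((Real.sqrt ‖u‖ : ℝ) : ℂ) := by
  classical
  haveI : Algebra.IsQuadraticExtension (Fp L) L := IsCMField.isQuadraticExtension L
  have hc : IsCMField.complexConj L ≠ 1 := IsCMField.complexConj_ne_one L
  have hdetw : detDelta (Fp L) L (IsCMField.complexConj L) v n w p = u := by rw [hdet, hu]
  have hunit : IsUnit (detDelta (Fp L) L (IsCMField.complexConj L) v n w p) := by rw [hdetw]; exact isUnit_iff_ne_zero.2 hu0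
  have hue : hunit.unit = Units.mk0 u hu0 := Units.ext (by rw [IsUnit.unit_spec, hdetw, Units.val_mk0])
  have hchi : LocalSplitting.chiDet (Fp L) L (IsCMField.complexConj L) v n (fun w' : UnitaryGroup.PlacesOver L v => (χ.localComponent w'.1)⁻¹) p =
      (χ.localComponent w.1 (Units.mk0 u hu0))⁻¹ := by
    unfold LocalSplitting.chiDet
    rw [PlacesOver.prod_eq_of_smul_eq (IsCMField.complexConj L) hc w hw, dif_pos hunit, hue, MonoidHom.inv_apply]
  rw [hchi, inv_inv, PlacesOver.prod_eq_of_smul_eq (IsCMField.complexConj L) hc w hw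
    (fun w' => Real.sqrt ‖detDelta (Fp L) L (IsCMField.complexConj L) v n w' p‖), hdetw]

end Scalar

/-! ## §3 Frame eigenvalues separate: a vector with a partner has a well-defined eigenvalue -/

section Separate

variable {F E : Type} [Field F] [NumberField F] [Field E] [NumberField E] [Algebra F E] (c : E ≃ₐ[F] E)
  (v : HeightOneSpectrum (𝓞 F)) (n : ℕ) {T₀ : Matrix (Fin n) (Fin n) F}

/-- **eigenvalues on a vector with a partner are well defined**: `M y = α y = β y` and `h(y*, y) = 1` ⇒ `α = β`
(★ `eq_zero_of_smul_eq_zero_of_partner`). Road use: `X₊`, `X₀`, `{t₁⁻¹}` are pairwise disjoint since `ϖ ≠ 1 ≠ ϖ⁻¹ ≠ ϖ`.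
[cite: Dieudonne1971GroupesClassiques, Chap. II §5] -/
theorem eq_of_mulVec_eq_smul_of_partner {y ys : Fin n → UnitaryGroup.LocalRing E v}
    (hsy : hermForm (conjLocal E c v) (gramS F E v n T₀) ys y = 1) {M : Matrix (Fin n) (Fin n) (UnitaryGroup.LocalRing E v)}
    {α β : UnitaryGroup.LocalRing E v} (h1 : M *ᵥ y = α • y) (h2 : M *ᵥ y = β • y) : α = β :=
  sub_eq_zero.1 (eq_zero_of_smul_eq_zero_of_partner F E c v n hsy (α - β) (by rw [sub_smul, ← h1, ← h2, sub_self]))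

end Separate

end Summit.HodgeConjecture.HodgeConjecture.Cruxes.HLiu418.K2LiuInertSiegelScalars

end
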